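import Summits.CriticalPhenomena.CardyFormulaZ2.Theorems.DyadicBetaRigidityDyadicLatticeBetaLawStubS1OfSubseqCI
import Summits.CriticalPhenomena.CardyFormulaZ2.Theorems.DyadicBetaRigidityDyadicLatticeBetaLawStubDyadicSubseqCI
import Summits.CriticalPhenomena.CardyFormulaZ2.Theorems.DyadicBetaRigidityDyadicLatticeBetaLawStubMeshNormalForm
import Summits.CriticalPhenomena.CardyFormulaZ2.Theorems.DyadicBetaRigidityDyadicLatticeBetaLawStubSubseqCIOfDyadic
import Summits.CriticalPhenomena.CardyFormulaZ2.Theorems.DyadicBetaRigidityDyadicLatticeBetaLawStubCruxIffPolyomino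
import Summits.CriticalPhenomena.CardyFormulaZ2.Theses.CardyBlackNoise
import Summits.CriticalPhenomena.CardyFormulaZ2.Theses.CardyMirrorMonotone

/-!
# The hard stub S1 of line `Sketch` IS subsequential conformal invariance (stmt-4678)

Crux `DyadicLatticeBetaLaw` (stmt-CriticalPhenomena-18183, route `DyadicBetaRigidity` of
`CardyFormulaZ2`), line `Sketch` (skeleton `Cruxes/DyadicLatticeBetaLaw/Lines/Sketch.lean`).
Capstone of lead cycle c1 (registered support stub `stub_S1_iff_subseqCI`): the line's one open
stub S1 `stub_equicontinuousComparison` — the equicontinuous equimodular comparison of lattice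
polygons along the dyadic ladders `h/2^k` — is EQUIVALENT, unconditionally and with everything
kernel-checked, to the existing target item `CardyExpCovariance.SubseqConformalInvariance`
(stmt-CriticalPhenomena-4678: every mesh sequence has a subsequence along which the bond-`ℤ²`
crossing probabilities of all conformal rectangles converge to a function of the modulus):

* `→` : S1 gives dyadic subsequential conformal invariance (`stub_dyadicSubseqCI_of_S1`: the
  landed S5b cluster law + S2 sandwich), the mesh normal form `u = c · 2^{-m}`
  (`stub_meshNormalForm`) and the tree's scale continuity (`ClusterSetConnected.scaleContinuity`,
  stmt-5770) with exact dilation covariance upgrade it to arbitrary mesh sequences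
  (`stub_subseqCI_of_dyadicSubseqCI`);
* `←` : `stub_equicontinuousComparison_of_subseqCI` (box equicontinuity in the width, strict
  antitonicity of the rectangle modulus, dilation covariance, fitted meshes).

Corollaries recorded here (the structural position of the crux among the neighbouring routes):
`DyadicLatticeBetaLaw → SubseqConformalInvariance` (no rigidity), `SubseqConformalInvariance →
CardyRigiditySeq → DyadicLatticeBetaLaw` (through the line), hence modulo the sequential rigidity
item stmt-4680 the four statements `DyadicLatticeBetaLaw` (stmt-18183), `PolyominoGaussianLaw`
(stmt-14337, `stub_crux_iff_polyominoGaussianLaw`), S1 and `SubseqConformalInvariance`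
(stmt-4678) are pairwise equivalent, and `CardyFormulaZ2 ↔ SubseqConformalInvariance ∧
CardyRigiditySeq` (the deciding implication of route CardyExpCovariance made an `iff`). The two
verbatim copies of stmt-4678 in other routes — `CardyBlackNoise.SubseqConformalInvariance`
(stmt-8846) and `CardyMirrorMonotone.SubseqConformalInvariance` (stmt-8266, quantifiers re-packaged)
— are recorded as equivalent, so S1 ≡ stmt-4678 ≡ stmt-8846 ≡ stmt-8266. Finally the
lattice-polygon / dyadic restrictions of the crux are idle (`crux_iff_betaLawAll`: the crux is the
all-rectangle all-mesh beta law with a free exponent) and modulo the route's own rigidity item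
stmt-0746 the crux is `CardyFormulaZ2` itself (`crux_iff_cardyFormulaZ2`).

References: B. Bollobás, O. Riordan, *Percolation* (2006), Ch. 7; S. Smirnov, C. R. Acad. Sci.
Paris 333 (2001); O. Schramm, Proc. ICM 2006, Problem 2.11.
-/

noncomputable section

open MeasureTheory Filter Set Metric Topology
open UpperHalfPlane (upperHalfPlaneSet)
open Literature.Probability.RandomPlanarGeometry Literature.Probability.LatticeModels
open Literature.Probability.Percolation
open Summit.CriticalPhenomena.CardyFormulaZ2.Theses

namespace Summit.CriticalPhenomena.CardyFormulaZ2.Cruxes.DyadicLatticeBetaLaw.Stubs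

/-- **S1 ↔ `SubseqConformalInvariance`** (registered support stub `stub_S1_iff_subseqCI` of crux
stmt-CriticalPhenomena-18183, line `Sketch`): the equicontinuous equimodular comparison of
lattice polygons along the dyadic ladders (stub S1, verbatim) holds iff every mesh sequence
`u → 0⁺` has a subsequence along which the bond-`ℤ²` crossing probabilities of all conformal
rectangles converge to a function of the modulus (item stmt-CriticalPhenomena-4678 of route
CardyExpCovariance). [cite: BollobasRiordan2006, Ch. 7 §7.1] -/
theorem stub_S1_iff_subseqCI :
    (∀ ε : ℝ, 0 < ε → ∀ η ∈ Set.Ioo (0 : ℝ) 1, ∃ θ : ℝ, 0 < θ ∧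
      ∀ h h' : ℝ, 0 < h → 0 < h' → ∀ R R' : ConformalRectangle,
        (∃ S : Finset (ℂ × ℂ), (∀ p ∈ S, ∃ u v : Site 2, (zdGraph 2).Adj u v ∧
            p.1 = meshPoint h u ∧ p.2 = meshPoint h v) ∧
            frontier R.carrier ⊆ ⋃ p ∈ S, segment ℝ p.1 p.2) →
        (∃ S : Finset (ℂ × ℂ), (∀ p ∈ S, ∃ u v : Site 2, (zdGraph 2).Adj u v ∧
            p.1 = meshPoint h' u ∧ p.2 = meshPoint h' v) ∧
            frontier R'.carrier ⊆ ⋃ p ∈ S, segment ℝ p.1 p.2) →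
        ∀ (φ : ConformalEquiv upperHalfPlaneSet R.carrier) (x : Fin 4 → ℝ)
          (φ' : ConformalEquiv upperHalfPlaneSet R'.carrier) (x' : Fin 4 → ℝ),
          R.IsUniformizing φ x → R'.IsUniformizing φ' x' →
          |crossRatio x - η| < θ → |crossRatio x' - η| < θ →
          ∀ᶠ k : ℕ in atTop,
            |bondDomainCrossingProb R (h / 2 ^ k) - bondDomainCrossingProb R' (h' / 2 ^ k)| < ε) ↔
    Summit.CriticalPhenomena.CardyFormulaZ2.Theses.CardyExpCovariance.SubseqConformalInvariance :=
  ⟨fun hS1 => stub_subseqCI_of_dyadicSubseqCI stub_meshNormalForm (stub_dyadicSubseqCI_of_S1 hS1),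
    stub_equicontinuousComparison_of_subseqCI⟩

/-- **The crux implies subsequential conformal invariance** (no rigidity needed):
`DyadicLatticeBetaLaw → SubseqConformalInvariance` (crux ⇒ S1 by uniform continuity of `I_a`,
then S1 ⇒ stmt-4678). [cite: BollobasRiordan2006, Ch. 7 §7.1] -/
theorem subseqCI_of_crux (hC : DyadicBetaRigidity.DyadicLatticeBetaLaw) :
    CardyExpCovariance.SubseqConformalInvariance :=
  stub_S1_iff_subseqCI.1 (stub_equicontinuousComparison_of_crux hC)

/-- **Subsequential conformal invariance and sequential rigidity imply the crux, through line
`Sketch`**: `SubseqConformalInvariance → CardyRigiditySeq → DyadicLatticeBetaLaw`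
(stmt-4678 ⇒ S1, then the landed composition `crux_of_comparison_of_rigiditySeq`).
[cite: BollobasRiordan2006, Ch. 7 §7.1] -/
theorem crux_of_subseqCI_of_rigiditySeq (hX : CardyExpCovariance.SubseqConformalInvariance)
    (hRig : CardyExpCovariance.CardyRigiditySeq) : DyadicBetaRigidity.DyadicLatticeBetaLaw :=
  crux_of_comparison_of_rigiditySeq (stub_equicontinuousComparison_of_subseqCI hX) hRig

/-- **Modulo sequential rigidity the crux IS subsequential conformal invariance**:
given `CardyRigiditySeq` (stmt-4680), `DyadicLatticeBetaLaw ↔ SubseqConformalInvariance`.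
[cite: BollobasRiordan2006, Ch. 7 §7.1] -/
theorem crux_iff_subseqCI (hRig : CardyExpCovariance.CardyRigiditySeq) :
    DyadicBetaRigidity.DyadicLatticeBetaLaw ↔ CardyExpCovariance.SubseqConformalInvariance :=
  ⟨subseqCI_of_crux, fun hX => crux_of_subseqCI_of_rigiditySeq hX hRig⟩

/-- **`PolyominoGaussianLaw` implies subsequential conformal invariance** (stmt-14337 ⇒ stmt-18183
⇒ stmt-4678; no rigidity). [cite: BollobasRiordan2006, Ch. 7 §7.1] -/
theorem subseqCI_of_polyominoGaussianLaw (hP : CardyTensorRG.PolyominoGaussianLaw) :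
    CardyExpCovariance.SubseqConformalInvariance :=
  subseqCI_of_crux (stub_crux_iff_polyominoGaussianLaw.2 hP)

/-- **Modulo sequential rigidity, `PolyominoGaussianLaw` IS subsequential conformal invariance**
(stmt-14337 ↔ stmt-4678 given stmt-4680). [cite: BollobasRiordan2006, Ch. 7 §7.1] -/
theorem polyominoGaussianLaw_iff_subseqCI (hRig : CardyExpCovariance.CardyRigiditySeq) :
    CardyTensorRG.PolyominoGaussianLaw ↔ CardyExpCovariance.SubseqConformalInvariance :=
  stub_crux_iff_polyominoGaussianLaw.symm.trans (crux_iff_subseqCI hRig)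

/-- **Cardy's formula on `ℤ²` ↔ subsequential conformal invariance ∧ sequential rigidity**:
the deciding implication `SubseqConformalInvariance → CardyRigiditySeq → CardyFormulaZ2` of route
CardyExpCovariance is an equivalence (`→`: the landed `stub_cardyFormulaZ2_iff_comparison_and_rigiditySeq`
gives S1 and rigidity from Cardy's formula, and S1 ⇒ stmt-4678). [cite: Smirnov2001, Thm 2] -/
theorem cardyFormulaZ2_iff_subseqCI_and_rigiditySeq :
    _root_.CardyFormulaZ2 ↔
      (CardyExpCovariance.SubseqConformalInvariance ∧ CardyExpCovariance.CardyRigiditySeq) := by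
  rw [stub_cardyFormulaZ2_iff_comparison_and_rigiditySeq]
  exact ⟨fun h => ⟨stub_S1_iff_subseqCI.1 h.1, h.2⟩, fun h => ⟨stub_S1_iff_subseqCI.2 h.1, h.2⟩⟩

/-- **The lattice-polygon and dyadic restrictions of the crux are idle**: `DyadicLatticeBetaLaw`
is EQUIVALENT to the all-rectangle, all-mesh beta law `∃ a ∈ (0,1), ∀ R, R.HasCrossingLimit I_a`
(`→`: the route's proved glue `DyadicBetaSuffices_proof`; `←`: restriction along `h/2^k → 0⁺`).
[cite: BollobasRiordan2006, Ch. 7 remark p. 195] -/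
theorem crux_iff_betaLawAll :
    DyadicBetaRigidity.DyadicLatticeBetaLaw ↔
      ∃ a : ℝ, a ∈ Set.Ioo (0 : ℝ) 1 ∧ ∀ R : ConformalRectangle,
        R.HasCrossingLimit (bondDomainCrossingProb R)
          (fun η : ℝ => (∫ s in (0 : ℝ)..η, (s * (1 - s)) ^ (-a)) /
            ∫ s in (0 : ℝ)..1, (s * (1 - s)) ^ (-a)) := by
  constructor
  · rintro ⟨a, ha, hD⟩
    exact ⟨a, ha, Summit.CriticalPhenomena.CardyFormulaZ2.Theorems.DyadicBetaSuffices_proof a ha hD⟩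
  · rintro ⟨a, ha, hall⟩
    refine ⟨a, ha, fun h hh R _ φ x hφ => ?_⟩
    exact (hall R φ x hφ).comp (tendsto_dyadicMesh' hh)

/-- **Modulo the route's own rigidity item** `DyadicBetaRigidity.CardyRigidity`
(stmt-CriticalPhenomena-0746) **the crux IS Cardy's formula on `ℤ²`** (`→`: the route's deciding
theorem `DyadicBetaRigidity.closes` with the proved glue; `←`: landed `crux_of_cardyFormulaZ2`).
[cite: Smirnov2001, Thm 2] -/
theorem crux_iff_cardyFormulaZ2 (hRig : DyadicBetaRigidity.CardyRigidity) :
    DyadicBetaRigidity.DyadicLatticeBetaLaw ↔ _root_.CardyFormulaZ2 :=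
  ⟨fun hC => DyadicBetaRigidity.closes hC hRig
      Summit.CriticalPhenomena.CardyFormulaZ2.Theorems.DyadicBetaSuffices_proof,
    crux_of_cardyFormulaZ2⟩

/-- The target `CardyBlackNoise.SubseqConformalInvariance` (stmt-CriticalPhenomena-8846) is
stmt-4678 verbatim. [folklore] -/
theorem subseqCI_iff_blackNoise :
    CardyExpCovariance.SubseqConformalInvariance ↔ CardyBlackNoise.SubseqConformalInvariance :=
  Iff.rfl

/-- The target `CardyMirrorMonotone.SubseqConformalInvariance` (X_M, stmt-CriticalPhenomena-8266)
is stmt-4678 with the two existential quantifiers re-packaged. [folklore] -/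
theorem subseqCI_iff_mirrorMonotone :
    CardyExpCovariance.SubseqConformalInvariance ↔ CardyMirrorMonotone.SubseqConformalInvariance :=
  ⟨fun h u hu => by
      obtain ⟨ψ, f, hψ, hf⟩ := h u hu
      exact ⟨ψ, hψ, f, hf⟩,
    fun h u hu => by
      obtain ⟨ψ, hψ, f, hf⟩ := h u hu
      exact ⟨ψ, f, hψ, hf⟩⟩

/-- Hence **S1 ↔ X_M** (stmt-CriticalPhenomena-8266) as well. [folklore] -/
theorem S1_iff_mirrorMonotone :
    (∀ ε : ℝ, 0 < ε → ∀ η ∈ Set.Ioo (0 : ℝ) 1, ∃ θ : ℝ, 0 < θ ∧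
      ∀ h h' : ℝ, 0 < h → 0 < h' → ∀ R R' : ConformalRectangle,
        (∃ S : Finset (ℂ × ℂ), (∀ p ∈ S, ∃ u v : Site 2, (zdGraph 2).Adj u v ∧
            p.1 = meshPoint h u ∧ p.2 = meshPoint h v) ∧
            frontier R.carrier ⊆ ⋃ p ∈ S, segment ℝ p.1 p.2) →
        (∃ S : Finset (ℂ × ℂ), (∀ p ∈ S, ∃ u v : Site 2, (zdGraph 2).Adj u v ∧
            p.1 = meshPoint h' u ∧ p.2 = meshPoint h' v) ∧
            frontier R'.carrier ⊆ ⋃ p ∈ S, segment ℝ p.1 p.2) →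
        ∀ (φ : ConformalEquiv upperHalfPlaneSet R.carrier) (x : Fin 4 → ℝ)
          (φ' : ConformalEquiv upperHalfPlaneSet R'.carrier) (x' : Fin 4 → ℝ),
          R.IsUniformizing φ x → R'.IsUniformizing φ' x' →
          |crossRatio x - η| < θ → |crossRatio x' - η| < θ →
          ∀ᶠ k : ℕ in atTop,
            |bondDomainCrossingProb R (h / 2 ^ k) - bondDomainCrossingProb R' (h' / 2 ^ k)| < ε) ↔
    CardyMirrorMonotone.SubseqConformalInvariance :=
  stub_S1_iff_subseqCI.trans subseqCI_iff_mirrorMonotone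

end Summit.CriticalPhenomena.CardyFormulaZ2.Cruxes.DyadicLatticeBetaLaw.Stubs

end
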